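import Mathlib
import HarnessLib
import Summits.CriticalPhenomena.SAWScalingLimit.Theses.SAWLoopLift
import Literature.MeasureTheory.RandomSets.AvoidanceFunctional
import Summits.CriticalPhenomena.SAWScalingLimit.Theorems.SAWLoopLiftWernerDeterminationTopology
import Summits.CriticalPhenomena.SAWScalingLimit.Theorems.SAWLoopLiftWernerDeterminationHyperspace
import Summits.CriticalPhenomena.SAWScalingLimit.Theorems.SAWLoopLiftWernerDeterminationExhaustion
import Summits.CriticalPhenomena.SAWScalingLimit.Theorems.SAWLoopLiftWernerDeterminationMass
import Summits.CriticalPhenomena.SAWScalingLimit.Theorems.SAWLoopLiftWernerDeterminationGeneration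
import Summits.CriticalPhenomena.SAWScalingLimit.Theorems.SAWLoopLiftWernerDeterminationLoops

/-!
# `WernerDetermination` (route SAWLoopLift, item stmt-CriticalPhenomena-4851) — proved

Werner's determination lemma in hyperspace form (W. Werner, *The conformally invariant measure on
self-avoiding loops*, J. Amer. Math. Soc. 21 (2008), arXiv:math/0511605, proof of Prop. 3 / Lemma 4): two
measures `ν, ν'` on `NonemptyCompacts ℂ`, both carried by simple-loop traces inside `B(0, R)` and giving
every event `{T ⊆ U, T surrounds z, T ⊄ V}` (Jordan `V ⊆ U ⊆ B(0, R)`, `z ∈ V`) the mass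
`c · log (|φ_U'(0)| / |φ_V'(0)|)` with the same `c > 0`, are equal.

Proof (assembling the helper files `SAWLoopLiftWernerDetermination{Topology, Hyperspace, Exhaustion, Mass,
Generation, Loops}`):
1. Riemann maps centred at `z` exist for every Jordan domain (tree: Riemann mapping theorem and simple
   connectivity of Jordan domains), so `ν` and `ν'` agree, with finite value, on the events of all Jordan
   pairs (`hJ`); only this consequence of the conformal-radius masses is used.
2. The carrier is covered by countably many such events `E_i = E(B(0,R), B(d,r), d)` (`d` in a countable
   dense set, `r` rational; Jordan curve theorem: a simple loop surrounds the points of its inside), so it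
   suffices that the finite measures `ν|E_i`, `ν'|E_i` agree.
3. For fixed `d`, the events `{T ⊆ W, T surrounds d}` over open sets `W` WITHOUT HOLES form a π-system on
   which `ν|E_i = ν'|E_i` (exhaustion of simply connected domains by Jordan domains, `Mass`); by the π-λ
   theorem they agree on the generated σ-algebra.
4. That σ-algebra contains, up to the null set of non-loops, every miss event `{T ∩ U = ∅}`, `U` open
   (`Generation`, Jordan curve theorem); so the two finite measures have the same avoidance functional and
   coincide (`Literature.MeasureTheory.RandomSets.AvoidanceFunctional.ext_of_forall_measure_setOf_disjoint_eq`,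
   Choquet–Matheron–Molchanov uniqueness).

References: W. Werner, J. Amer. Math. Soc. 21 (2008), §3; I. Molchanov, *Theory of Random Sets* (2005),
§1.6 and App. C.
-/

noncomputable section

namespace Summit.CriticalPhenomena.SAWScalingLimit.Theorems.WernerDetermination

open Set Metric Bornology Topology Filter TopologicalSpace MeasureTheory
open scoped ENNReal
open Literature.Probability.RandomPlanarGeometry
open Literature.MeasureTheory.RandomSets (ext_of_forall_measure_setOf_disjoint_eq)

/-- The event "`T ⊆ W` and `T` surrounds `z`" of the route item (local notation). -/
local notation3 "around " z " inW " W => {T : NonemptyCompacts ℂ | (T : Set ℂ) ⊆ W ∧ z ∉ (T : Set ℂ) ∧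
  IsBounded (connectedComponentIn (T : Set ℂ)ᶜ z)}

/-- The π-system of such events over open sets `W` without holes (local notation). -/
local notation3 "piSys " z => {S : Set (NonemptyCompacts ℂ) | ∃ W : Set ℂ, IsOpen W ∧
  (∀ a ∈ Wᶜ, ¬ IsBounded (connectedComponentIn Wᶜ a)) ∧ S = around z inW W}

/-- The event `E(U, V, z)` of the route item (local notation). -/
local notation3 "evt " z " inW " U " notIn " V => {T : NonemptyCompacts ℂ | (T : Set ℂ) ⊆ U ∧ z ∉ (T : Set ℂ) ∧
  IsBounded (connectedComponentIn (T : Set ℂ)ᶜ z) ∧ ¬ (T : Set ℂ) ⊆ V}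

/-- `T` is the trace of a simple loop (local notation for the carrier hypothesis of the item). -/
local notation3 "IsLoopTrace " T => ∃ γ : CurveClass ℂ,
  γ ∈ (CurveClass.simpleLoop : Set (CurveClass ℂ)) ∧ γ.range = (T : Set ℂ)

variable [MeasurableSpace (NonemptyCompacts ℂ)] [BorelSpace (NonemptyCompacts ℂ)]

/-- **Step 3 (π-λ): agreement on the generated σ-algebra, restricted to a cover piece.** Under the
Jordan-pair agreement `hJ` and connectedness of the carried sets, for `0 < r`, the restrictions of `ν, ν'`
to `E = E(B(0,R), B(d,r), d)` (an event of finite equal mass) agree on every set measurable for the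
σ-algebra generated by `piSys d` (`MeasurableSpace.induction_on_inter` with `measure_around_inter_event_eq`).
[folklore] -/
theorem restrict_apply_eq_of_generateFrom {ν ν' : Measure (NonemptyCompacts ℂ)} {R : ℝ}
    (hJ : ∀ (U V : JordanDomain) (z : ℂ), U.carrier ⊆ ball 0 R → V.carrier ⊆ U.carrier → z ∈ V.carrier →
      ν (evt z inW U.carrier notIn V.carrier) = ν' (evt z inW U.carrier notIn V.carrier) ∧
        ν (evt z inW U.carrier notIn V.carrier) < ∞)
    (hconn : ∀ᵐ T : NonemptyCompacts ℂ ∂ν, IsPreconnected (T : Set ℂ))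
    (hconn' : ∀ᵐ T : NonemptyCompacts ℂ ∂ν', IsPreconnected (T : Set ℂ))
    {d : ℂ} {r : ℝ} (hr : 0 < r)
    (hE : ν (evt d inW (ball 0 R) notIn (ball d r)) = ν' (evt d inW (ball 0 R) notIn (ball d r)))
    (hEfin : ν (evt d inW (ball 0 R) notIn (ball d r)) < ∞)
    {A : Set (NonemptyCompacts ℂ)} (hA : MeasurableSet[MeasurableSpace.generateFrom (piSys d)] A) :
    ν.restrict (evt d inW (ball 0 R) notIn (ball d r)) A = ν'.restrict (evt d inW (ball 0 R) notIn (ball d r)) A := by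
  have hEm : MeasurableSet (evt d inW (ball 0 R) notIn (ball d r)) := measurableSet_event d isOpen_ball isOpen_ball
  have hle := generateFrom_piSys_le d
  induction A, hA using MeasurableSpace.induction_on_inter (m := MeasurableSpace.generateFrom (piSys d)) rfl
    (isPiSystem_piSys d) with
  | empty => simp
  | basic A hA =>
    obtain ⟨W, hWo, hWh, rfl⟩ := hA
    rw [Measure.restrict_apply' hEm, Measure.restrict_apply' hEm]
    exact measure_around_inter_event_eq hJ hconn hconn' hr hWo hWh
  | compl A hAm ih =>
    have hAm' : MeasurableSet A := hle _ hAm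
    haveI : IsFiniteMeasure (ν.restrict (evt d inW (ball 0 R) notIn (ball d r))) :=
      ⟨by rw [Measure.restrict_apply_univ]; exact hEfin⟩
    haveI : IsFiniteMeasure (ν'.restrict (evt d inW (ball 0 R) notIn (ball d r))) :=
      ⟨by rw [Measure.restrict_apply_univ, ← hE]; exact hEfin⟩
    rw [measure_compl hAm' (measure_ne_top _ _), measure_compl hAm' (measure_ne_top _ _), ih,
      Measure.restrict_apply_univ, Measure.restrict_apply_univ, hE]
  | iUnion f hdisj hfm ih =>
    have hfm' : ∀ i, MeasurableSet (f i) := fun i => hle _ (hfm i)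
    rw [measure_iUnion hdisj hfm', measure_iUnion hdisj hfm']
    exact tsum_congr ih

/-- **Steps 3–4: the restrictions to a cover piece coincide.** Under `hJ`, if `ν, ν'` are carried by simple
loop traces, then for `0 < r` and `B(d, r) ⊆ B(0, R)` the finite measures `ν|E`, `ν'|E`,
`E = E(B(0,R), B(d,r), d)`, have the same avoidance functional — the miss event of an open `U` agrees a.e.
with a set of the generated σ-algebra (`exists_measurableSet_generateFrom_disjoint_of_isOpen`, the loops in
`E` surround `d` and satisfy (J1), (J2) by `good_of_simpleLoop`) — hence are equal
(`ext_of_forall_measure_setOf_disjoint_eq`). [folklore] -/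
theorem restrict_evt_eq {ν ν' : Measure (NonemptyCompacts ℂ)} {R : ℝ}
    (hJ : ∀ (U V : JordanDomain) (z : ℂ), U.carrier ⊆ ball 0 R → V.carrier ⊆ U.carrier → z ∈ V.carrier →
      ν (evt z inW U.carrier notIn V.carrier) = ν' (evt z inW U.carrier notIn V.carrier) ∧
        ν (evt z inW U.carrier notIn V.carrier) < ∞)
    (hL : ∀ᵐ T : NonemptyCompacts ℂ ∂ν, IsLoopTrace T) (hL' : ∀ᵐ T : NonemptyCompacts ℂ ∂ν', IsLoopTrace T)
    {d : ℂ} {r : ℝ} (hr : 0 < r) (hrR : ball d r ⊆ ball 0 R) :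
    ν.restrict (evt d inW (ball 0 R) notIn (ball d r)) = ν'.restrict (evt d inW (ball 0 R) notIn (ball d r)) := by
  have hEm : MeasurableSet (evt d inW (ball 0 R) notIn (ball d r)) := measurableSet_event d isOpen_ball isOpen_ball
  -- the piece is an event of a Jordan pair: finite equal masses
  have hR : 0 < R := nonempty_ball.1 ⟨d, hrR (mem_ball_self hr)⟩
  obtain ⟨UR, hUR⟩ := exists_jordanDomain_carrier_eq_ball (0 : ℂ) hR
  obtain ⟨V, hV⟩ := exists_jordanDomain_carrier_eq_ball d hr
  obtain ⟨hE, hEfin⟩ : ν (evt d inW (ball 0 R) notIn (ball d r)) = ν' (evt d inW (ball 0 R) notIn (ball d r)) ∧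
      ν (evt d inW (ball 0 R) notIn (ball d r)) < ∞ := by
    have := hJ UR V d (by rw [hUR]) (by rw [hUR, hV]; exact hrR) (by rw [hV]; exact mem_ball_self hr)
    rwa [hUR, hV] at this
  haveI : IsFiniteMeasure (ν.restrict (evt d inW (ball 0 R) notIn (ball d r))) :=
    ⟨by rw [Measure.restrict_apply_univ]; exact hEfin⟩
  have hconn : ∀ᵐ T : NonemptyCompacts ℂ ∂ν, IsPreconnected (T : Set ℂ) :=
    hL.mono fun T hT => isPreconnected_of_simpleLoop hT
  have hconn' : ∀ᵐ T : NonemptyCompacts ℂ ∂ν', IsPreconnected (T : Set ℂ) :=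
    hL'.mono fun T hT => isPreconnected_of_simpleLoop hT
  refine ext_of_forall_measure_setOf_disjoint_eq _ _ ?_ fun U hU => ?_
  · rw [Measure.restrict_apply_univ, Measure.restrict_apply_univ, hE]
  obtain ⟨A, hAm, hA⟩ := exists_measurableSet_generateFrom_disjoint_of_isOpen d hU
  -- on the piece, almost every `T` is a simple loop surrounding `d`, hence good
  have hgood : ∀ (μ : Measure (NonemptyCompacts ℂ)), (∀ᵐ T : NonemptyCompacts ℂ ∂μ, IsLoopTrace T) →
      ({K : NonemptyCompacts ℂ | Disjoint (K : Set ℂ) U} : Set (NonemptyCompacts ℂ))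
        =ᵐ[μ.restrict (evt d inW (ball 0 R) notIn (ball d r))] A := by
    intro μ hμ
    have h' : ∀ᵐ T : NonemptyCompacts ℂ ∂μ.restrict (evt d inW (ball 0 R) notIn (ball d r)),
        T ∈ (evt d inW (ball 0 R) notIn (ball d r)) := ae_restrict_mem hEm
    filter_upwards [ae_restrict_of_ae hμ, h'] with T hT hTE
    exact propext (hA T (good_of_simpleLoop hT hTE.2.1 hTE.2.2.1))
  rw [measure_congr (hgood ν hL), measure_congr (hgood ν' hL')]
  exact restrict_apply_eq_of_generateFrom hJ hconn hconn' hr hE hEfin hAm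

omit [MeasurableSpace (NonemptyCompacts ℂ)] [BorelSpace (NonemptyCompacts ℂ)] in
/-- **`WernerDetermination` holds** (item stmt-CriticalPhenomena-4851): Werner's determination lemma in
hyperspace form — two measures on `NonemptyCompacts ℂ` carried by simple-loop traces in `B(0, R)` with the
same conformal-radius masses `c · log (|φ_U'(0)| / |φ_V'(0)|)` on all events
`{T ⊆ U, T surrounds z, T ⊄ V}` (Jordan `V ⊆ U ⊆ B(0,R)`, `z ∈ V`) are equal. W. Werner, J. Amer. Math.
Soc. 21 (2008), proof of Prop. 3 / Lemma 4. [folklore] -/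
theorem wernerDetermination_proof :
    Summit.CriticalPhenomena.SAWScalingLimit.Theses.SAWLoopLift.WernerDetermination := by
  letI : MeasurableSpace (NonemptyCompacts ℂ) := borel _
  haveI : BorelSpace (NonemptyCompacts ℂ) := ⟨rfl⟩
  intro ν ν' c R _ hL hL' hB hB' hM hM'
  -- Step 1: agreement with finite value on the events of all Jordan pairs (Riemann maps exist)
  have hJ : ∀ (U V : JordanDomain) (z : ℂ), U.carrier ⊆ ball 0 R → V.carrier ⊆ U.carrier → z ∈ V.carrier →
      ν (evt z inW U.carrier notIn V.carrier) = ν' (evt z inW U.carrier notIn V.carrier) ∧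
        ν (evt z inW U.carrier notIn V.carrier) < ∞ := by
    intro U V z hU hVU hz
    obtain ⟨φ, hφ⟩ := JordanDomain.exists_conformalEquiv_apply_zero U (hVU hz)
    obtain ⟨ψ, hψ⟩ := JordanDomain.exists_conformalEquiv_apply_zero V hz
    have e1 := hM U V z φ ψ hU hVU hz hφ hψ
    have e2 := hM' U V z φ ψ hU hVU hz hφ hψ
    exact ⟨e1.trans e2.symm, e1 ▸ ENNReal.ofReal_lt_top⟩
  -- Step 2: the countable cover of the carrier
  obtain ⟨D, hDc, hDd⟩ := TopologicalSpace.exists_countable_dense ℂ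
  set I : Set (ℂ × ℚ) := {p : ℂ × ℚ | p.1 ∈ D ∧ (0 : ℝ) < p.2 ∧ ball p.1 (p.2 : ℝ) ⊆ ball 0 R} with hI
  have hIc : I.Countable :=
    (hDc.prod (Set.countable_univ : (univ : Set ℚ).Countable)).mono
      fun p (hp : p ∈ I) => Set.mem_prod.2 ⟨hp.1, mem_univ _⟩
  haveI : Countable I := hIc.to_subtype
  set E : I → Set (NonemptyCompacts ℂ) :=
    fun p => evt (p : ℂ × ℚ).1 inW (ball 0 R) notIn (ball (p : ℂ × ℚ).1 ((p : ℂ × ℚ).2 : ℝ)) with hEdef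
  have hcover : ∀ (μ : Measure (NonemptyCompacts ℂ)), (∀ᵐ T : NonemptyCompacts ℂ ∂μ, IsLoopTrace T) →
      (∀ᵐ T : NonemptyCompacts ℂ ∂μ, (T : Set ℂ) ⊆ ball 0 R) → ∀ᵐ T : NonemptyCompacts ℂ ∂μ, T ∈ ⋃ p, E p := by
    intro μ h1 h2
    filter_upwards [h1, h2] with T hT hTR
    obtain ⟨d, hdD, q, hq, hqR, hTE⟩ := exists_mem_evt_of_simpleLoop hDd hT hTR
    exact mem_iUnion.2 ⟨⟨(d, q), hdD, hq, hqR⟩, hTE⟩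
  rw [← Measure.restrict_eq_self_of_ae_mem (hcover ν hL hB),
    ← Measure.restrict_eq_self_of_ae_mem (hcover ν' hL' hB')]
  -- Steps 3–4 on each piece
  refine Measure.restrict_iUnion_congr.2 fun p => ?_
  exact restrict_evt_eq hJ hL hL' p.2.2.1 p.2.2.2

end Summit.CriticalPhenomena.SAWScalingLimit.Theorems.WernerDetermination
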